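import Summits.QuantumAdvantage.AdviceFreeQNC0.BlockAdditiveCounts
import HarnessLib

/-!
# Cell qa-qnc0 (rung F-Q1, crux α `RingToElim`, many-blocks corner of qn-p1 ROUND-12 / `Sketch13`):
# the degree-`0` tensor bound for the `k`-block SUM CODE — transversal certificates, every `k`

Planner qa-qnc0-p1 (gen 13, `HOME/qa-qnc0-p1/ROUND-12.md` §2, `Sketch13.lean`, ask P18) types the
`k`-block sum code at block degree `t`: `win = ⊕_{j<k} X_j`, where on every block-`j` fibre `X_j` is
the win pattern of an EVEN TRIPLE `T_{|u_j| mod 3}` (`T₀ ⊕ T₁ ⊕ T₂ ≡ 0`) of degree `≤ t` in the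
block's own bits, and asks (`TensorMultZeroAll`) for the degree-`0` rung: `#FAIL ≥ β^k·2ⁿ` for every
`β < 1/3`, uniformly in the number of blocks `k`, once the blocks are large.

This file proves the degree-`0` bound for an ARBITRARY block map `bl : Fin n → ℕ` (blocks
`bl⁻¹(j)`, `j < k`; coordinates with `bl i ≥ k` are free), in the form the reduction consumes:

* `SumCodeZero.prod_mul_le_card_fails`: if for every `j < k` each residue class
  `{a : bw_j(a) ≡ r (3)}` (`r = 0,1,2`, full vectors `a ∈ {0,1}ⁿ`) has at least `γ_j·2ⁿ` elements
  (`γ_j ≥ 0`), then every degree-`0` system fails on at least `(Π_{j<k} γ_j)·2ⁿ` inputs.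
  Proof (ROUND-12 §2.4(c)/(d), "sequential betting", induction on `k`): pick in each residue class of
  the last block a cheapest full assignment `a_r`; the XOR of the three restrictions
  `u ↦ FAIL(u ⊕_k a_r)` is again the FAIL function of a `k−1`-block degree-`0` system (the last
  triple cancels because it is even, the other triples are summed pointwise), so by induction it has
  `≥ (Π_{j<k-1} γ_j)·2ⁿ` points, whence one of the three restrictions is at least as heavy up to the
  factor `3`… — precisely: `#FAIL·2ⁿ = Σ_a #FAIL(· ⊕_k a) ≥ Σ_r #cls_r · #FAIL(· ⊕_k a_r)
  ≥ γ_{k-1} 2ⁿ · Σ_r #FAIL(· ⊕_k a_r) ≥ γ_{k-1} 2ⁿ · #FAIL'` (the first equality is the block-swap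
  involution on pairs).
* `SumCodeZero.sum_card_filter_ovr` (the double count) and the parity bookkeeping it needs.

The residue-class sizes (`3·#cls ≥ 2ⁿ − 2·2^{n−m_j}`), the block sizes of `Sketch13.blockIdx` and the
assembly `tensorMult_zero : 0 ≤ β → β < 1/3 → TensorMult 0 β` are in `TensorMultZero.lean`.

WHAT THIS IS NOT: nothing at block degree `t ≥ 1` (`TensorMultOne`, the crux MULT₁, is open); no
block splitting (`BlockSplit`) here; nothing on α itself; separation NOT moved.
-/

namespace Summit.QuantumAdvantage.AdviceFreeQNC0

open Finset

namespace SumCodeZero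

variable {n : ℕ} (bl : Fin n → ℕ)

/-! ### Blocks, block weights, residue classes, the win indicator -/

/-- Override the block-`j` bits of `u` by those of `a` (`Sketch13.mergeBlock` for a general block map). -/
def ovr (j : ℕ) (u a : Fin n → Bool) : Fin n → Bool := fun i => if bl i = j then a i else u i

/-- Hamming weight of block `j` (`Sketch13.blockWt` for a general block map). -/
def bw (j : ℕ) (u : Fin n → Bool) : ℕ := (univ.filter fun i : Fin n => bl i = j ∧ u i = true).card

/-- The full vectors whose block-`j` weight is `≡ r (mod 3)`. -/
def cls (j r : ℕ) : Finset (Fin n → Bool) := univ.filter fun a : Fin n → Bool => bw bl j a % 3 = r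

/-- WIN indicator of the `k`-block system `T` (`T j r` = the `r`-th member of block `j`'s triple):
`win(u) = ⊕_{j<k} T_j,(bw_j(u) mod 3)(u)`. -/
def win (k : ℕ) (T : ℕ → ℕ → (Fin n → Bool) → Bool) (u : Fin n → Bool) : Bool :=
  decide (((range k).filter fun j => T j (bw bl j u % 3) u = true).card % 2 = 1)

/-- The FAIL set of the `k`-block system `T`. -/
def fails (k : ℕ) (T : ℕ → ℕ → (Fin n → Bool) → Bool) : Finset (Fin n → Bool) :=
  univ.filter fun u : Fin n → Bool => win bl k T u = false

/-! ### Elementary lemmas on overriding -/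

variable {bl}

/-- Overrides of two different blocks commute. -/
theorem ovr_comm {j j' : ℕ} (hj : j ≠ j') (u a b : Fin n → Bool) :
    ovr bl j (ovr bl j' u b) a = ovr bl j' (ovr bl j u a) b := by
  funext i
  unfold ovr
  by_cases h : bl i = j
  · have h' : ¬ bl i = j' := fun h'' => hj (h.symm.trans h'')
    simp only [if_pos h, if_neg h']
  · by_cases h' : bl i = j'
    · simp only [if_neg h, if_pos h']
    · simp only [if_neg h, if_neg h']

/-- The block-`j` weight of an override of block `j` is that of the overriding vector. -/
theorem bw_ovr_same (j : ℕ) (u a : Fin n → Bool) : bw bl j (ovr bl j u a) = bw bl j a := by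
  unfold bw ovr
  congr 1
  ext i
  simp only [mem_filter, mem_univ, true_and]
  constructor
  · rintro ⟨h, h'⟩; rw [if_pos h] at h'; exact ⟨h, h'⟩
  · rintro ⟨h, h'⟩; rw [if_pos h]; exact ⟨h, h'⟩

/-- The block-`j'` weight is unchanged by an override of another block. -/
theorem bw_ovr_ne {j j' : ℕ} (hj : j ≠ j') (u a : Fin n → Bool) : bw bl j' (ovr bl j u a) = bw bl j' u := by
  unfold bw ovr
  congr 1
  ext i
  simp only [mem_filter, mem_univ, true_and]
  constructor
  · rintro ⟨h, h'⟩
    rw [if_neg (fun h'' : bl i = j => hj (h''.symm.trans h))] at h'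
    exact ⟨h, h'⟩
  · rintro ⟨h, h'⟩
    rw [if_neg (fun h'' : bl i = j => hj (h''.symm.trans h))]
    exact ⟨h, h'⟩

/-- The block swap on pairs `(a, u) ↦ (u ⊕_j a, a ⊕_j u)` is an involution. -/
theorem swap_involutive (j : ℕ) :
    Function.Involutive (fun p : (Fin n → Bool) × (Fin n → Bool) => (ovr bl j p.2 p.1, ovr bl j p.1 p.2)) := by
  intro p
  obtain ⟨a, u⟩ := p
  simp only [Prod.mk.injEq]
  constructor
  · funext i
    unfold ovr
    by_cases h : bl i = j <;> simp [h]
  · funext i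
    unfold ovr
    by_cases h : bl i = j <;> simp [h]

/-- **The double count**: `Σ_a #{u : P(u ⊕_j a)} = 2ⁿ · #{w : P w}` (block-swap involution on pairs). -/
theorem sum_card_filter_ovr (j : ℕ) (P : (Fin n → Bool) → Prop) [DecidablePred P] :
    ∑ a : Fin n → Bool, (univ.filter fun u : Fin n → Bool => P (ovr bl j u a)).card =
      2 ^ n * (univ.filter fun w : Fin n → Bool => P w).card := by
  classical
  set σ := (swap_involutive (bl := bl) j).toPerm _ with hσ
  calc ∑ a : Fin n → Bool, (univ.filter fun u : Fin n → Bool => P (ovr bl j u a)).card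
      = ∑ a : Fin n → Bool, ∑ u : Fin n → Bool, (if P (ovr bl j u a) then 1 else 0) := by
        refine Finset.sum_congr rfl fun a _ => ?_
        exact Finset.card_filter _ _
    _ = ∑ p : (Fin n → Bool) × (Fin n → Bool), (if P (ovr bl j p.2 p.1) then 1 else 0) :=
        (Fintype.sum_prod_type' (fun a u => if P (ovr bl j u a) then 1 else 0)).symm
    _ = ∑ p : (Fin n → Bool) × (Fin n → Bool),
          (fun q : (Fin n → Bool) × (Fin n → Bool) => if P q.1 then 1 else 0) (σ p) := by
        rfl
    _ = ∑ q : (Fin n → Bool) × (Fin n → Bool), (if P q.1 then 1 else 0) :=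
        Equiv.sum_comp σ (fun q : (Fin n → Bool) × (Fin n → Bool) => if P q.1 then 1 else 0)
    _ = ∑ w : Fin n → Bool, ∑ _b : Fin n → Bool, (if P w then 1 else 0) :=
        Fintype.sum_prod_type _
    _ = ∑ w : Fin n → Bool, 2 ^ n * (if P w then 1 else 0) := by
        refine Finset.sum_congr rfl fun w _ => ?_
        rw [Finset.sum_const, Finset.card_univ, smul_eq_mul, Fintype.card_fun, Fintype.card_bool,
          Fintype.card_fin]
    _ = 2 ^ n * (univ.filter fun w : Fin n → Bool => P w).card := by
        rw [Finset.card_filter, Finset.mul_sum]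

/-! ### Parity bookkeeping -/

/-- `#{j ∈ s : p j ⊕ q j} ≡ #{j ∈ s : p j} + #{j ∈ s : q j} (mod 2)`. -/
theorem card_filter_xor_mod_two {ι : Type*} [DecidableEq ι] (s : Finset ι) (p q : ι → Bool) :
    (s.filter fun j => xor (p j) (q j) = true).card % 2 =
      ((s.filter fun j => p j = true).card + (s.filter fun j => q j = true).card) % 2 := by
  induction s using Finset.induction_on with
  | empty => simp
  | insert a s ha ih =>
    rw [filter_insert, filter_insert, filter_insert]
    cases hp : p a <;> cases hq : q a <;>
      simp only [Bool.xor_false, Bool.xor_true, Bool.not_false, Bool.not_true, Bool.false_eq_true,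
        if_true, if_false, card_insert_of_notMem (fun h => ha (mem_of_mem_filter a h))] <;> omega

/-- `[(a + 1) odd] = ¬[a odd]` and friends: `decide ((a + b) % 2 = 1) = [a odd] ⊕ [b odd]`. -/
theorem decide_add_mod_two (a b : ℕ) :
    decide ((a + b) % 2 = 1) = xor (decide (a % 2 = 1)) (decide (b % 2 = 1)) := by
  rcases Nat.mod_two_eq_zero_or_one a with ha | ha <;>
    rcases Nat.mod_two_eq_zero_or_one b with hb | hb <;>
      simp [Nat.add_mod, ha, hb]

/-- Nine Booleans: the XOR of three even triples, regrouped, is even. -/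
private theorem xor_regroup (a0 a1 a2 b0 b1 b2 c0 c1 c2 : Bool)
    (ha : xor a0 (xor a1 a2) = false) (hb : xor b0 (xor b1 b2) = false)
    (hc : xor c0 (xor c1 c2) = false) :
    xor (xor a0 (xor b0 c0)) (xor (xor a1 (xor b1 c1)) (xor a2 (xor b2 c2))) = false := by
  revert a0 a1 a2 b0 b1 b2 c0 c1 c2
  decide

/-- Six Booleans: if `b₀ ⊕ b₁ ⊕ b₂ = 0` then `⊕_s (d_s ⊕ b_s) = ⊕_s d_s`. -/
private theorem xor_cancel (d0 d1 d2 b0 b1 b2 : Bool) (hb : xor b0 (xor b1 b2) = false) :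
    xor (xor d0 b0) (xor (xor d1 b1) (xor d2 b2)) = xor d0 (xor d1 d2) := by
  revert d0 d1 d2 b0 b1 b2
  decide

/-! ### The induction -/

/-- **Degree-0 tensor bound for the sum code (every number of blocks).**  For a block map `bl`,
a `k`-block system `T` whose triples depend only on OFF-block bits (`T j r (u ⊕_j a) = T j r u`)
and are even (`T j 0 ⊕ T j 1 ⊕ T j 2 ≡ 0`), and weights `γ_j ≥ 0` with
`γ_j·2ⁿ ≤ #{a : bw_j(a) ≡ r (3)}` for all `j < k`, `r < 3`:
`(Π_{j<k} γ_j)·2ⁿ ≤ #FAIL`. -/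
theorem prod_mul_le_card_fails (k : ℕ) (T : ℕ → ℕ → (Fin n → Bool) → Bool)
    (hoff : ∀ j < k, ∀ (r : ℕ) (u a : Fin n → Bool), T j r (ovr bl j u a) = T j r u)
    (heven : ∀ j < k, ∀ u : Fin n → Bool, xor (T j 0 u) (xor (T j 1 u) (T j 2 u)) = false)
    (γ : ℕ → ℝ) (hγ0 : ∀ j < k, 0 ≤ γ j)
    (hγ : ∀ j < k, ∀ r < 3, γ j * (2 : ℝ) ^ n ≤ ((cls bl j r).card : ℝ)) :
    (∏ j ∈ range k, γ j) * (2 : ℝ) ^ n ≤ ((fails bl k T).card : ℝ) := by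
  classical
  induction k generalizing T with
  | zero =>
    have hf : fails bl 0 T = univ := by
      ext u
      simp [fails, win]
    rw [prod_range_zero, one_mul, hf, card_univ, Fintype.card_fun, Fintype.card_bool, Fintype.card_fin]
    push_cast
    exact le_rfl
  | succ k ih =>
    -- the cost of overriding the last block by a fixed full vector `a`
    set G : (Fin n → Bool) → ℕ := fun a =>
      (univ.filter fun u : Fin n → Bool => win bl (k + 1) T (ovr bl k u a) = false).card with hG
    have hγk0 : 0 ≤ γ k := hγ0 k (Nat.lt_succ_self k)
    have hprod : ∏ j ∈ range (k + 1), γ j = (∏ j ∈ range k, γ j) * γ k := prod_range_succ _ _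
    -- degenerate case: an empty residue class of the last block forces `γ k = 0`
    by_cases hne : ∀ r < 3, (cls bl k r).Nonempty
    swap
    · simp only [not_forall, Finset.not_nonempty_iff_eq_empty] at hne
      obtain ⟨r, hr, hr0⟩ := hne
      have h0 : γ k * (2 : ℝ) ^ n ≤ 0 := by
        have := hγ k (Nat.lt_succ_self k) r hr
        rw [hr0, card_empty] at this
        exact_mod_cast this
      have hγk : γ k = 0 := by
        have h2 : (0 : ℝ) < (2 : ℝ) ^ n := by positivity
        nlinarith
      rw [hprod, hγk, mul_zero, zero_mul]
      positivity
    -- cheapest representative of each residue class of the last block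
    obtain ⟨a0, ha0, hmin0⟩ := exists_min_image (cls bl k 0) G (hne 0 (by norm_num))
    obtain ⟨a1, ha1, hmin1⟩ := exists_min_image (cls bl k 1) G (hne 1 (by norm_num))
    obtain ⟨a2, ha2, hmin2⟩ := exists_min_image (cls bl k 2) G (hne 2 (by norm_num))
    have hbw0 : bw bl k a0 % 3 = 0 := (mem_filter.1 ha0).2
    have hbw1 : bw bl k a1 % 3 = 1 := (mem_filter.1 ha1).2
    have hbw2 : bw bl k a2 % 3 = 2 := (mem_filter.1 ha2).2
    -- the (k)-block system obtained by XOR-ing the three restrictions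
    set T' : ℕ → ℕ → (Fin n → Bool) → Bool := fun j r u =>
      xor (T j r (ovr bl k u a0)) (xor (T j r (ovr bl k u a1)) (T j r (ovr bl k u a2))) with hT'
    have hoff' : ∀ j < k, ∀ (r : ℕ) (u a : Fin n → Bool), T' j r (ovr bl j u a) = T' j r u := by
      intro j hj r u a
      have hjk : k ≠ j := fun h => (lt_irrefl j) (h ▸ hj)
      simp only [hT']
      rw [ovr_comm hjk, ovr_comm hjk, ovr_comm hjk, hoff j (Nat.lt_succ_of_lt hj),
        hoff j (Nat.lt_succ_of_lt hj), hoff j (Nat.lt_succ_of_lt hj)]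
    have heven' : ∀ j < k, ∀ u : Fin n → Bool,
        xor (T' j 0 u) (xor (T' j 1 u) (T' j 2 u)) = false := by
      intro j hj u
      simp only [hT']
      exact xor_regroup _ _ _ _ _ _ _ _ _ (heven j (Nat.lt_succ_of_lt hj) _)
        (heven j (Nat.lt_succ_of_lt hj) _) (heven j (Nat.lt_succ_of_lt hj) _)
    -- the win indicator of an override of the last block
    have hwin_ovr : ∀ (a u : Fin n → Bool) (s : ℕ), bw bl k a % 3 = s →
        win bl (k + 1) T (ovr bl k u a) =
          xor (decide (((range k).filter fun j =>
            T j (bw bl j u % 3) (ovr bl k u a) = true).card % 2 = 1)) (T k s u) := by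
      intro a u s hs
      unfold win
      rw [range_add_one, filter_insert, bw_ovr_same, hs, hoff k (Nat.lt_succ_self k)]
      have hfilt : ((range k).filter fun j => T j (bw bl j (ovr bl k u a) % 3) (ovr bl k u a) = true) =
          (range k).filter fun j => T j (bw bl j u % 3) (ovr bl k u a) = true := by
        refine filter_congr fun j hj => ?_
        rw [bw_ovr_ne (fun h => by have := mem_range.1 hj; omega)]
      cases hk : T k s u
      · rw [if_neg (by simp), hfilt, Bool.xor_false]
      · rw [if_pos rfl, card_insert_of_notMem (fun h => notMem_range_self (mem_of_mem_filter k h)),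
          hfilt, Bool.xor_true, decide_add_mod_two]
        simp
    -- pointwise: FAIL' = ⊕ of the three restricted FAILs (as win indicators)
    have hpt : ∀ u : Fin n → Bool, win bl k T' u =
        xor (win bl (k + 1) T (ovr bl k u a0))
          (xor (win bl (k + 1) T (ovr bl k u a1)) (win bl (k + 1) T (ovr bl k u a2))) := by
      intro u
      rw [hwin_ovr a0 u 0 hbw0, hwin_ovr a1 u 1 hbw1, hwin_ovr a2 u 2 hbw2,
        xor_cancel _ _ _ _ _ _ (heven k (Nat.lt_succ_self k) u)]
      unfold win
      simp only [hT']
      rw [card_filter_xor_mod_two, decide_add_mod_two]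
      congr 1
      have h2 : ((range k).filter fun j => xor (T j (bw bl j u % 3) (ovr bl k u a1))
            (T j (bw bl j u % 3) (ovr bl k u a2)) = true).card % 2 =
          (((range k).filter fun j => T j (bw bl j u % 3) (ovr bl k u a1) = true).card +
            ((range k).filter fun j => T j (bw bl j u % 3) (ovr bl k u a2) = true).card) % 2 :=
        card_filter_xor_mod_two _ _ _
      rw [show decide (((range k).filter fun j => xor (T j (bw bl j u % 3) (ovr bl k u a1))
            (T j (bw bl j u % 3) (ovr bl k u a2)) = true).card % 2 = 1) =
          decide ((((range k).filter fun j => T j (bw bl j u % 3) (ovr bl k u a1) = true).card +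
            ((range k).filter fun j => T j (bw bl j u % 3) (ovr bl k u a2) = true).card) % 2 = 1) by
          rw [h2], decide_add_mod_two]
    -- union bound: #FAIL' ≤ G a0 + G a1 + G a2
    have hunion : (fails bl k T').card ≤ G a0 + G a1 + G a2 := by
      have hsub : fails bl k T' ⊆
          (univ.filter fun u : Fin n → Bool => win bl (k + 1) T (ovr bl k u a0) = false) ∪
          (univ.filter fun u : Fin n → Bool => win bl (k + 1) T (ovr bl k u a1) = false) ∪
          (univ.filter fun u : Fin n → Bool => win bl (k + 1) T (ovr bl k u a2) = false) := by
        intro u hu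
        rw [fails, mem_filter, hpt u] at hu
        simp only [mem_union, mem_filter, mem_univ, true_and]
        revert hu
        cases win bl (k + 1) T (ovr bl k u a0) <;> cases win bl (k + 1) T (ovr bl k u a1) <;>
          cases win bl (k + 1) T (ovr bl k u a2) <;> simp
      calc (fails bl k T').card
          ≤ ((univ.filter fun u : Fin n → Bool => win bl (k + 1) T (ovr bl k u a0) = false) ∪
            (univ.filter fun u : Fin n → Bool => win bl (k + 1) T (ovr bl k u a1) = false) ∪
            (univ.filter fun u : Fin n → Bool => win bl (k + 1) T (ovr bl k u a2) = false)).card :=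
            card_le_card hsub
        _ ≤ _ := by
            refine le_trans (card_union_le _ _) ?_
            have := card_union_le
              (univ.filter fun u : Fin n → Bool => win bl (k + 1) T (ovr bl k u a0) = false)
              (univ.filter fun u : Fin n → Bool => win bl (k + 1) T (ovr bl k u a1) = false)
            simp only [hG]
            omega
    -- induction hypothesis for T'
    have hIH : (∏ j ∈ range k, γ j) * (2 : ℝ) ^ n ≤ ((fails bl k T').card : ℝ) :=
      ih T' hoff' heven' (fun j hj => hγ0 j (Nat.lt_succ_of_lt hj))
        (fun j hj r hr => hγ j (Nat.lt_succ_of_lt hj) r hr)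
    -- the double count and the class decomposition (in ℕ)
    have hsum : ∑ a : Fin n → Bool, G a = 2 ^ n * (fails bl (k + 1) T).card := by
      simp only [hG, fails]
      exact sum_card_filter_ovr k (fun w => win bl (k + 1) T w = false)
    have hfib : ∑ r ∈ range 3, ∑ a ∈ cls bl k r, G a = ∑ a : Fin n → Bool, G a := by
      unfold cls
      exact sum_fiberwise_of_maps_to (fun a _ => mem_range.2 (Nat.mod_lt _ (by norm_num))) G
    have hcl0 : (cls bl k 0).card * G a0 ≤ ∑ a ∈ cls bl k 0, G a := by
      have := card_nsmul_le_sum (cls bl k 0) G (G a0) fun a ha => hmin0 a ha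
      simpa using this
    have hcl1 : (cls bl k 1).card * G a1 ≤ ∑ a ∈ cls bl k 1, G a := by
      have := card_nsmul_le_sum (cls bl k 1) G (G a1) fun a ha => hmin1 a ha
      simpa using this
    have hcl2 : (cls bl k 2).card * G a2 ≤ ∑ a ∈ cls bl k 2, G a := by
      have := card_nsmul_le_sum (cls bl k 2) G (G a2) fun a ha => hmin2 a ha
      simpa using this
    have hnat : (cls bl k 0).card * G a0 + (cls bl k 1).card * G a1 + (cls bl k 2).card * G a2 ≤
        2 ^ n * (fails bl (k + 1) T).card := by
      rw [← hsum, ← hfib]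
      simp only [sum_range_succ, sum_range_zero, zero_add]
      omega
    -- assemble in ℝ
    have hγc0 := hγ k (Nat.lt_succ_self k) 0 (by norm_num)
    have hγc1 := hγ k (Nat.lt_succ_self k) 1 (by norm_num)
    have hγc2 := hγ k (Nat.lt_succ_self k) 2 (by norm_num)
    have hreal : (((cls bl k 0).card * G a0 + (cls bl k 1).card * G a1 +
        (cls bl k 2).card * G a2 : ℕ) : ℝ) ≤ ((2 ^ n * (fails bl (k + 1) T).card : ℕ) : ℝ) := by
      exact_mod_cast hnat
    push_cast at hreal
    have hun : ((fails bl k T').card : ℝ) ≤ (G a0 : ℝ) + (G a1 : ℝ) + (G a2 : ℝ) := by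
      exact_mod_cast hunion
    have h2n : (0 : ℝ) < (2 : ℝ) ^ n := by positivity
    have hG0 : (0 : ℝ) ≤ (G a0 : ℝ) := Nat.cast_nonneg _
    have hG1 : (0 : ℝ) ≤ (G a1 : ℝ) := Nat.cast_nonneg _
    have hG2 : (0 : ℝ) ≤ (G a2 : ℝ) := Nat.cast_nonneg _
    have key : (∏ j ∈ range (k + 1), γ j) * (2 : ℝ) ^ n * (2 : ℝ) ^ n ≤
        ((fails bl (k + 1) T).card : ℝ) * (2 : ℝ) ^ n := by
      calc (∏ j ∈ range (k + 1), γ j) * (2 : ℝ) ^ n * (2 : ℝ) ^ n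
          = (γ k * (2 : ℝ) ^ n) * ((∏ j ∈ range k, γ j) * (2 : ℝ) ^ n) := by rw [hprod]; ring
        _ ≤ (γ k * (2 : ℝ) ^ n) * ((G a0 : ℝ) + (G a1 : ℝ) + (G a2 : ℝ)) :=
            mul_le_mul_of_nonneg_left (hIH.trans hun) (mul_nonneg hγk0 h2n.le)
        _ = (γ k * (2 : ℝ) ^ n) * (G a0 : ℝ) + (γ k * (2 : ℝ) ^ n) * (G a1 : ℝ) +
              (γ k * (2 : ℝ) ^ n) * (G a2 : ℝ) := by ring
        _ ≤ ((cls bl k 0).card : ℝ) * (G a0 : ℝ) + ((cls bl k 1).card : ℝ) * (G a1 : ℝ) +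
              ((cls bl k 2).card : ℝ) * (G a2 : ℝ) := by
            have e0 := mul_le_mul_of_nonneg_right hγc0 hG0
            have e1 := mul_le_mul_of_nonneg_right hγc1 hG1
            have e2 := mul_le_mul_of_nonneg_right hγc2 hG2
            linarith
        _ ≤ (2 : ℝ) ^ n * ((fails bl (k + 1) T).card : ℝ) := hreal
        _ = ((fails bl (k + 1) T).card : ℝ) * (2 : ℝ) ^ n := by ring
    exact le_of_mul_le_mul_right key h2n

end SumCodeZero

end Summit.QuantumAdvantage.AdviceFreeQNC0
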